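import Literature.Probability.Percolation.BondTwoArmsAKN
import HarnessLib

/-!
# Cerf's two-arms bound (DKT 2020, (38)) with the constant made EXPLICIT

Topic `Literature/Probability/Percolation`.  Duminil-Copin–Kozma–Tassion, *Upper bounds on the percolation correlation
length* (arXiv:1902.03207), §7 (38) = Cerf, Ann. Probab. 43 (2015), Prop. 5.2, bond version, uniformly in `p ∈ [δ, 1-δ]`:
`P_p(edgeTwoArms i m) ≤ κ (1 + log m)/√m`.  The tree's `AKN.exists_real_edgeTwoArms_le` (`BondTwoArmsAKN.lean`) proves it with
`∃ κ`; its proof already CONSTRUCTS `κ = max(3, C₁, C₂)`, `C₁ = 3^d √(8 d² 3^{d-1})`, `C₂ = 3^d (16 d²/δ) e^{(2d+1/2)²/(4c₀)}`,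
`c₀ = 2δ²(1-δ)²`.  This file names that constant (`AKN.aknKappa d δ`) and restates the SAME printed bound with it
(`AKN.real_edgeTwoArms_le_explicit`); the proof is the tree's, verbatim, with the existential removed.  Wanted by the QUANT lane's
explicit-rate programme (run/shared/lean/prim/quant/LADDER.md R5 S6; builds on p205010 (kernel theorem, internal audit signed;
external expert review pending)) so that DKT's Proposition 1 can be stated with closed-form `(α, n₁)`
(`CerfUniquenessZoneBoundExplicit.lean`).

## References
* H. Duminil-Copin, G. Kozma, V. Tassion, arXiv:1902.03207, §7 (38) [DuminilcopinKozmaTassion2020].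
* R. Cerf, Ann. Probab. 43 (2015), Prop. 5.2 (arXiv:1306.3105) [Cerf2015].
-/

noncomputable section

namespace Literature.Probability.Percolation

namespace AKN

open _root_.MeasureTheory LatticeModels Finset GM
open scoped Classical

variable {d : ℕ}

/-- **The explicit AKN/Cerf constant** `κ(d, δ) = max(3, 3^d √(8 d² 3^{d-1}), 3^d · (16 d²/δ) · exp((2d + 1/2)²/(8 δ²(1-δ)²)))`
— the witness constructed in the tree proof of `exists_real_edgeTwoArms_le` (Cerf 2015 Prop. 5.2 / DKT 2020 (38)), named.
[cite: Cerf2015, Prop 5.2] [cite: DuminilcopinKozmaTassion2020, §7 (38)] -/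
def aknKappa (d : ℕ) (δ : ℝ) : ℝ :=
  max 3 (max ((3 : ℝ) ^ d * Real.sqrt (8 * (d : ℝ) ^ 2 * 3 ^ (d - 1)))
    ((3 : ℝ) ^ d * (16 * (d : ℝ) ^ 2 / δ) * Real.exp ((2 * d + 1 / 2) ^ 2 / (4 * (2 * δ ^ 2 * (1 - δ) ^ 2)))))

/-- `3 ≤ aknKappa d δ` (in particular it is positive). [cite: Cerf2015, Prop 5.2] -/
theorem three_le_aknKappa (d : ℕ) (δ : ℝ) : 3 ≤ aknKappa d δ := le_max_left _ _

/-- **Cerf 2015, Proposition 5.2, bond version, uniformly in `p ∈ [δ, 1-δ]`, EXPLICIT constant** (= DKT 2020, (38)):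
for `d ≥ 1` and `0 < δ ≤ 1/2`, for all `p ∈ [δ, 1-δ]`, all directions `i` and all `m ≥ 1`,
`P_p(edgeTwoArms i m) ≤ aknKappa d δ · (1 + log m)/√m`.  Same proof as `exists_real_edgeTwoArms_le` (verbatim), the witness named.
[cite: Cerf2015, Prop 5.2] [cite: DuminilcopinKozmaTassion2020, §7 (38)] -/
theorem real_edgeTwoArms_le_explicit (hd : 1 ≤ d) {δ : ℝ} (hδ0 : 0 < δ) (hδ : δ ≤ 1 / 2) :
    ∀ p : unitInterval, δ ≤ (p : ℝ) → (p : ℝ) ≤ 1 - δ → ∀ i : Fin d, ∀ m : ℕ, 1 ≤ m →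
      (bondPercolation (zdGraph d) p).real (edgeTwoArms i m) ≤ aknKappa d δ * (1 + Real.log m) / Real.sqrt m := by
  -- constants
  have h1δ : 0 < 1 - δ := by linarith
  obtain ⟨c₀, hc₀⟩ : ∃ c₀ : ℝ, c₀ = 2 * δ ^ 2 * (1 - δ) ^ 2 := ⟨_, rfl⟩
  have hc₀pos : 0 < c₀ := by rw [hc₀]; positivity
  obtain ⟨K₀, hK₀⟩ : ∃ K₀ : ℝ, K₀ = Real.exp ((2 * d + 1 / 2) ^ 2 / (4 * c₀)) := ⟨_, rfl⟩
  have hK₀0 : 0 < K₀ := by rw [hK₀]; exact Real.exp_pos _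
  obtain ⟨C₁, hC₁⟩ : ∃ C₁ : ℝ, C₁ = (3 : ℝ) ^ d * Real.sqrt (8 * (d : ℝ) ^ 2 * 3 ^ (d - 1)) := ⟨_, rfl⟩
  obtain ⟨C₂, hC₂⟩ : ∃ C₂ : ℝ, C₂ = (3 : ℝ) ^ d * (16 * (d : ℝ) ^ 2 / δ) * K₀ := ⟨_, rfl⟩
  have hC₁0 : 0 ≤ C₁ := by rw [hC₁]; positivity
  have hC₂0 : 0 ≤ C₂ := by rw [hC₂]; positivity
  obtain ⟨κ, hκe, hκ⟩ : ∃ κ : ℝ, aknKappa d δ = κ ∧ κ = max 3 (max C₁ C₂) :=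
    ⟨_, rfl, by rw [hC₁, hC₂, hK₀, hc₀]; rfl⟩
  simp only [hκe]
  have hκ3 : (3 : ℝ) ≤ κ := by rw [hκ]; exact le_max_left _ _
  have hκ1 : C₁ ≤ κ := by rw [hκ]; exact (le_max_left _ _).trans (le_max_right _ _)
  have hκ2 : C₂ ≤ κ := by rw [hκ]; exact (le_max_right _ _).trans (le_max_right _ _)
  intro p hpδ hp1δ i m hm
  have hp0 : 0 < (p : ℝ) := hδ0.trans_le hpδ
  have hp1 : (p : ℝ) < 1 := by linarith only [hp1δ, hδ0]
  have hm0 : (0 : ℝ) < m := by exact_mod_cast hm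
  have hlog0 : 0 ≤ Real.log m := Real.log_nonneg (by exact_mod_cast hm)
  have hsqrt0 : 0 < Real.sqrt m := Real.sqrt_pos.2 hm0
  set μ := bondPercolation (zdGraph d) p with hμ
  -- small `m`: the trivial bound
  by_cases hm7 : m < 9
  · have h1 : μ.real (edgeTwoArms i m) ≤ 1 := measureReal_le_one
    rw [le_div_iff₀ hsqrt0]
    have hs3 : Real.sqrt m ≤ 3 := by
      rw [Real.sqrt_le_left (by norm_num)]
      have : (m : ℝ) ≤ 8 := by exact_mod_cast Nat.lt_succ_iff.1 hm7
      linarith only [this]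
    calc μ.real (edgeTwoArms i m) * Real.sqrt m ≤ 1 * 3 := mul_le_mul h1 hs3 hsqrt0.le zero_le_one
      _ ≤ κ * 1 := by linarith only [hκ3]
      _ ≤ κ * (1 + Real.log m) := mul_le_mul_of_nonneg_left (by linarith only [hlog0]) (by linarith only [hκ3])
  push Not at hm7
  -- `m ≥ 9`: `n = ⌊m/3⌋`, `ℓ = m − 2n`
  set n := m / 3 with hn
  have hn3 : 3 ≤ n := by omega
  have hn1 : 1 ≤ n := by omega
  have h2n : 2 * n ≤ m := by omega
  set ℓ := m - 2 * n with hℓ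
  have hmeq : 2 * n + ℓ = m := by omega
  -- the sizes, as reals, in terms of `M = m`
  set s := Real.log m with hs
  have hraw := card_mul_real_edgeTwoArms_le_raw (d := d) p hp0 hp1 i hn1 ℓ hlog0
  rw [hmeq] at hraw
  obtain ⟨E, hEdef⟩ : ∃ E : ℝ, E = ((edgesIn (zdGraph d) (box d n)).card : ℝ) := ⟨_, rfl⟩
  obtain ⟨A, hAdef⟩ : ∃ A : ℝ, A = ((box d n).card : ℝ) := ⟨_, rfl⟩
  obtain ⟨B, hBdef⟩ : ∃ B : ℝ, B = ((innerBoundary (zdGraph d) (box d (n + ℓ))).card : ℝ) := ⟨_, rfl⟩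
  rw [← hEdef, ← hAdef, ← hBdef] at hraw
  have hE0 : 0 ≤ E := by rw [hEdef]; exact Nat.cast_nonneg _
  have hA0 : 0 ≤ A := by rw [hAdef]; exact Nat.cast_nonneg _
  have hB0 : 0 ≤ B := by rw [hBdef]; exact Nat.cast_nonneg _
  have hMexp : (m : ℝ) = Real.exp s := by rw [hs, Real.exp_log hm0]
  have hA : A ≤ (m : ℝ) ^ d := by
    rw [hAdef, card_box, Nat.cast_pow]
    refine pow_le_pow_left₀ (by positivity) ?_ d
    have hnat : 2 * n + 1 ≤ m := by omega
    exact_mod_cast hnat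
  have hE : E ≤ 2 * d * (m : ℝ) ^ d := by
    have h := card_edgesIn_le (d := d) (box d n)
    have h' : ((edgesIn (zdGraph d) (box d n)).card : ℝ) ≤ 2 * d * ((box d n).card : ℝ) := by exact_mod_cast h
    rw [hEdef]
    rw [hAdef] at hA
    exact h'.trans (mul_le_mul_of_nonneg_left hA (by positivity))
  have hB : B ≤ 2 * d * (3 * (m : ℝ)) ^ (d - 1) := by
    have h := card_innerBoundary_box_le (d := d) (n + ℓ)
    have h' : ((innerBoundary (zdGraph d) (box d (n + ℓ))).card : ℝ) ≤ 2 * d * ((2 * (n + ℓ) + 1 : ℕ) : ℝ) ^ (d - 1) := by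
      exact_mod_cast h
    rw [hBdef]
    refine h'.trans (mul_le_mul_of_nonneg_left (pow_le_pow_left₀ (by positivity) ?_ _) (by positivity))
    have hnat : 2 * (n + ℓ) + 1 ≤ 3 * m := by omega
    exact_mod_cast hnat
  have hS : ((m : ℝ) / 3) ^ d ≤ ((box d (n - 1)).card : ℝ) := by
    rw [card_box, Nat.cast_pow]
    refine pow_le_pow_left₀ (by positivity) ?_ d
    have hnat : m ≤ 3 * (2 * (n - 1) + 1) := by omega
    have hreal : (m : ℝ) ≤ 3 * ((2 * (n - 1) + 1 : ℕ) : ℝ) := by exact_mod_cast hnat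
    rw [div_le_iff₀ (by norm_num : (0 : ℝ) < 3)]
    linarith only [hreal]
  -- bound the raw right-hand side
  have h1p : (1 - (p : ℝ)) ≤ 1 := by linarith only [p.2.1]
  have h1p0 : 0 ≤ 1 - (p : ℝ) := by linarith only [hp1]
  have hexp_le : Real.exp (-2 * (p : ℝ) ^ 2 * (1 - p) ^ 2 * s ^ 2) ≤ Real.exp (-(c₀ * s ^ 2)) := by
    apply Real.exp_le_exp.2
    have hprod : 0 ≤ ((p : ℝ) - δ) * (1 - δ - p) := mul_nonneg (by linarith only [hpδ]) (by linarith only [hp1δ])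
    have hprod' : ((p : ℝ) - δ) * (1 - δ - p) = p * (1 - p) - δ * (1 - δ) := by ring
    have hpq : δ * (1 - δ) ≤ (p : ℝ) * (1 - p) := by linarith only [hprod, hprod']
    have hpq0 : 0 ≤ δ * (1 - δ) := mul_nonneg hδ0.le h1δ.le
    have hsq : (δ * (1 - δ)) ^ 2 ≤ ((p : ℝ) * (1 - p)) ^ 2 := pow_le_pow_left₀ hpq0 hpq 2
    have hc : c₀ ≤ 2 * ((p : ℝ) * (1 - p)) ^ 2 := by
      have e0 : c₀ = 2 * (δ * (1 - δ)) ^ 2 := by rw [hc₀]; ring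
      linarith only [hsq, e0]
    have key : c₀ * s ^ 2 ≤ 2 * ((p : ℝ) * (1 - p)) ^ 2 * s ^ 2 := mul_le_mul_of_nonneg_right hc (sq_nonneg s)
    have e : 2 * ((p : ℝ) * (1 - p)) ^ 2 * s ^ 2 = -(-2 * (p : ℝ) ^ 2 * (1 - p) ^ 2 * s ^ 2) := by ring
    linarith only [key, e]
  -- term 1
  have hT1 : (1 - (p : ℝ)) * (s * Real.sqrt B * Real.sqrt (2 * E)) ≤
      s * (Real.sqrt (8 * (d : ℝ) ^ 2 * 3 ^ (d - 1)) * Real.exp ((2 * d - 1) * s / 2)) := by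
    have hBE : Real.sqrt B * Real.sqrt (2 * E) ≤ Real.sqrt (8 * (d : ℝ) ^ 2 * 3 ^ (d - 1)) * Real.exp ((2 * d - 1) * s / 2) := by
      rw [← Real.sqrt_mul hB0, ← sqrt_exp, ← Real.sqrt_mul (by positivity)]
      apply Real.sqrt_le_sqrt
      have h1 : B * (2 * E) ≤ (2 * d * (3 * (m : ℝ)) ^ (d - 1)) * (2 * (2 * d * (m : ℝ) ^ d)) :=
        mul_le_mul hB (by linarith only [hE]) (by positivity) (by positivity)
      refine h1.trans (le_of_eq ?_)
      have hpow : (3 * (m : ℝ)) ^ (d - 1) * (m : ℝ) ^ d = 3 ^ (d - 1) * Real.exp ((2 * d - 1) * s) := by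
        rw [mul_pow, hMexp, ← Real.exp_nat_mul, ← Real.exp_nat_mul, mul_assoc, ← Real.exp_add]
        congr 1
        push_cast [Nat.cast_sub hd]
        ring_nf
      calc 2 * (d : ℝ) * (3 * (m : ℝ)) ^ (d - 1) * (2 * (2 * d * (m : ℝ) ^ d))
          = 8 * (d : ℝ) ^ 2 * ((3 * (m : ℝ)) ^ (d - 1) * (m : ℝ) ^ d) := by ring
        _ = 8 * (d : ℝ) ^ 2 * 3 ^ (d - 1) * Real.exp ((2 * d - 1) * s) := by rw [hpow]; ring
    calc (1 - (p : ℝ)) * (s * Real.sqrt B * Real.sqrt (2 * E)) ≤ 1 * (s * Real.sqrt B * Real.sqrt (2 * E)) :=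
          mul_le_mul_of_nonneg_right h1p (by positivity)
      _ = s * (Real.sqrt B * Real.sqrt (2 * E)) := by ring
      _ ≤ s * (Real.sqrt (8 * (d : ℝ) ^ 2 * 3 ^ (d - 1)) * Real.exp ((2 * d - 1) * s / 2)) :=
          mul_le_mul_of_nonneg_left hBE hlog0
  -- term 2
  have hT2 : 2 * E / p * (2 * A * E * Real.exp (-2 * (p : ℝ) ^ 2 * (1 - p) ^ 2 * s ^ 2)) ≤
      16 * (d : ℝ) ^ 2 / δ * Real.exp (3 * d * s - c₀ * s ^ 2) := by
    have h1 : 2 * E / p ≤ 2 * (2 * d * (m : ℝ) ^ d) / δ := by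
      rw [div_le_div_iff₀ hp0 hδ0]
      calc 2 * E * δ ≤ 2 * (2 * d * (m : ℝ) ^ d) * δ :=
            mul_le_mul_of_nonneg_right (by linarith only [hE]) hδ0.le
        _ ≤ 2 * (2 * d * (m : ℝ) ^ d) * p := mul_le_mul_of_nonneg_left hpδ (by positivity)
    have h2 : 2 * A * E * Real.exp (-2 * (p : ℝ) ^ 2 * (1 - p) ^ 2 * s ^ 2) ≤
        2 * (m : ℝ) ^ d * (2 * d * (m : ℝ) ^ d) * Real.exp (-(c₀ * s ^ 2)) :=
      mul_le_mul (mul_le_mul (by linarith only [hA]) hE hE0 (by positivity)) hexp_le (Real.exp_pos _).le (by positivity)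
    calc 2 * E / p * (2 * A * E * Real.exp (-2 * (p : ℝ) ^ 2 * (1 - p) ^ 2 * s ^ 2))
        ≤ 2 * (2 * d * (m : ℝ) ^ d) / δ * (2 * (m : ℝ) ^ d * (2 * d * (m : ℝ) ^ d) * Real.exp (-(c₀ * s ^ 2))) :=
          mul_le_mul h1 h2 (by positivity) (by positivity)
      _ = 16 * (d : ℝ) ^ 2 / δ * (((m : ℝ) ^ d * (m : ℝ) ^ d * (m : ℝ) ^ d) * Real.exp (-(c₀ * s ^ 2))) := by ring
      _ = 16 * (d : ℝ) ^ 2 / δ * Real.exp (3 * d * s - c₀ * s ^ 2) := by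
          rw [hMexp, ← Real.exp_nat_mul, ← Real.exp_add, ← Real.exp_add, ← Real.exp_add]
          congr 2; ring
  -- the exponential bookkeeping
  have hquad : Real.exp (2 * d * s - c₀ * s ^ 2) ≤ K₀ * Real.exp (-(s / 2)) := by
    rw [hK₀, ← Real.exp_add]
    apply Real.exp_le_exp.2
    have := linear_sub_quad_le (2 * d + 1 / 2) hc₀pos s
    linarith only [this]
  have hsqrt : Real.sqrt m = Real.exp (s / 2) := by rw [hMexp, sqrt_exp]
  -- assemble: `(m/3)^d P ≤ ...`
  have hmain : ((m : ℝ) / 3) ^ d * μ.real (edgeTwoArms i m) ≤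
      s * (Real.sqrt (8 * (d : ℝ) ^ 2 * 3 ^ (d - 1)) * Real.exp ((2 * d - 1) * s / 2)) +
        16 * (d : ℝ) ^ 2 / δ * Real.exp (3 * d * s - c₀ * s ^ 2) := by
    calc ((m : ℝ) / 3) ^ d * μ.real (edgeTwoArms i m) ≤ ((box d (n - 1)).card : ℝ) * μ.real (edgeTwoArms i m) :=
          mul_le_mul_of_nonneg_right hS measureReal_nonneg
      _ ≤ _ := hraw
      _ ≤ _ := add_le_add hT1 hT2
  -- divide by `(m/3)^d = e^{ds}/3^d`
  have hmd : ((m : ℝ) / 3) ^ d = Real.exp (d * s) / 3 ^ d := by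
    rw [div_pow, hMexp, ← Real.exp_nat_mul]
  have hmd0 : 0 < ((m : ℝ) / 3) ^ d := by positivity
  have hP : μ.real (edgeTwoArms i m) ≤ (C₁ * s + C₂) * Real.exp (-(s / 2)) := by
    have h1 := (le_div_iff₀' hmd0).2 hmain
    refine h1.trans ?_
    rw [hmd, div_div_eq_mul_div, div_le_iff₀ (Real.exp_pos _)]
    -- `3^d (T1 + T2) ≤ (C₁ s + C₂) e^{-s/2} e^{ds}`
    have e1 : (3 : ℝ) ^ d * (s * (Real.sqrt (8 * (d : ℝ) ^ 2 * 3 ^ (d - 1)) * Real.exp ((2 * d - 1) * s / 2))) =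
        C₁ * s * (Real.exp (-(s / 2)) * Real.exp (d * s)) := by
      rw [hC₁, ← Real.exp_add]
      have : (2 * (d : ℝ) - 1) * s / 2 = -(s / 2) + d * s := by ring
      rw [this]; ring
    have e2 : (3 : ℝ) ^ d * (16 * (d : ℝ) ^ 2 / δ * Real.exp (3 * d * s - c₀ * s ^ 2)) =
        (3 : ℝ) ^ d * (16 * (d : ℝ) ^ 2 / δ) * (Real.exp (2 * d * s - c₀ * s ^ 2) * Real.exp (d * s)) := by
      rw [← Real.exp_add]
      have : 3 * (d : ℝ) * s - c₀ * s ^ 2 = 2 * d * s - c₀ * s ^ 2 + d * s := by ring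
      rw [this]; ring
    have e3 : (3 : ℝ) ^ d * (16 * (d : ℝ) ^ 2 / δ) * (Real.exp (2 * d * s - c₀ * s ^ 2) * Real.exp (d * s)) ≤
        C₂ * (Real.exp (-(s / 2)) * Real.exp (d * s)) := by
      rw [hC₂]
      have := mul_le_mul_of_nonneg_right hquad (Real.exp_pos (d * s)).le
      have h0 : 0 ≤ (3 : ℝ) ^ d * (16 * (d : ℝ) ^ 2 / δ) := by positivity
      calc (3 : ℝ) ^ d * (16 * (d : ℝ) ^ 2 / δ) * (Real.exp (2 * d * s - c₀ * s ^ 2) * Real.exp (d * s))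
          ≤ (3 : ℝ) ^ d * (16 * (d : ℝ) ^ 2 / δ) * (K₀ * Real.exp (-(s / 2)) * Real.exp (d * s)) :=
            mul_le_mul_of_nonneg_left this h0
        _ = _ := by ring
    calc (s * (Real.sqrt (8 * (d : ℝ) ^ 2 * 3 ^ (d - 1)) * Real.exp ((2 * d - 1) * s / 2)) +
          16 * (d : ℝ) ^ 2 / δ * Real.exp (3 * d * s - c₀ * s ^ 2)) * (3 : ℝ) ^ d
        = (3 : ℝ) ^ d * (s * (Real.sqrt (8 * (d : ℝ) ^ 2 * 3 ^ (d - 1)) * Real.exp ((2 * d - 1) * s / 2))) +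
            (3 : ℝ) ^ d * (16 * (d : ℝ) ^ 2 / δ * Real.exp (3 * d * s - c₀ * s ^ 2)) := by ring
      _ = C₁ * s * (Real.exp (-(s / 2)) * Real.exp (d * s)) +
            (3 : ℝ) ^ d * (16 * (d : ℝ) ^ 2 / δ) * (Real.exp (2 * d * s - c₀ * s ^ 2) * Real.exp (d * s)) := by
          rw [e1, e2]
      _ ≤ C₁ * s * (Real.exp (-(s / 2)) * Real.exp (d * s)) + C₂ * (Real.exp (-(s / 2)) * Real.exp (d * s)) :=
          add_le_add_right e3 _
      _ = (C₁ * s + C₂) * Real.exp (-(s / 2)) * Real.exp (d * s) := by ring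
  -- conclude
  rw [le_div_iff₀ hsqrt0, hsqrt]
  have hee : Real.exp (-(s / 2)) * Real.exp (s / 2) = 1 := by rw [← Real.exp_add]; simp
  calc μ.real (edgeTwoArms i m) * Real.exp (s / 2) ≤ (C₁ * s + C₂) * Real.exp (-(s / 2)) * Real.exp (s / 2) :=
        mul_le_mul_of_nonneg_right hP (Real.exp_pos _).le
    _ = C₁ * s + C₂ := by rw [mul_assoc, hee, mul_one]
    _ ≤ κ * s + κ * 1 := add_le_add (mul_le_mul_of_nonneg_right hκ1 hlog0) (by linarith only [hκ2])
    _ = κ * (1 + s) := by ring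


end AKN

end Literature.Probability.Percolation
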